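import Summits.BirchSwinnertonDyer.BirchSwinnertonDyer.Theorems.KimAtThreeShallowEqDeepStubOfOrder
import Summits.BirchSwinnertonDyer.BirchSwinnertonDyer.Theorems.KimAtThreeDeepUpperOfPorts
import HarnessLib

/-!
# Route `KimAtThreeKolyvagin` (rung W2), crux `ShallowEqDeepAtTorsionFree` (stmt-BirchSwinnertonDyer-19077):
# the STUB at the empty level FROM ORDERS — the `hStub` binder of the END-OF-PORTS theorem as a
# THEOREM of the port's witnesses at two depths

Cell `bsd-addord`, seat `bsd-addord-w2-c4` (D-0074 row B7), gen 4; sequel of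
`KimAtThreeShallowEqDeepStubOfOrder` (p442371: the algebra, the cartesian property of `𝓕_can` between two
prime-power levels, a class of full order from a deeper class).  TOOL theorems only (no definition, no
named fact, no `sorry`); nothing asserted about any particular curve; nothing booked; no mark moved.

WHAT.  In the currency of cell n1011's witness clauses `KatoKuriharaWitnessAt W k t D v₃ P κ Λ κ′`
(FLAG `K22-Thm3.13-PORT@3`; a HYPOTHESIS wherever used):
* `natCard_selmerGroup_le_of_ker` / `…_of_witness` — `#H¹_{𝓕_can}(ℚ, E[3^{k+1}]) ≤ 3^{k+1}·#H¹_𝓚`, i.e.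
  `n₀ ≤ s` for `#H¹_{𝓕_can} = 3^{k+1}·3^{n₀}`, `#H¹_𝓚 = 3^s` (the functional `Λ ∘ loc₃` has kernel in
  `H¹_𝓚` on `H¹_{𝓕_can}`: gen 3's `apply_localization_eq_zero_iff_mem_kummer_atLevel` at `∅`);
* **`exists_eq_nsmul_add_of_witnesses`** — at a depth `k` with `2n₀ + t + a ≤ k + 1`, given the witness
  at depth `k` (for `Φ = Λ ∘ loc₃` and `y₀ = κ_∅`, `Φ(κ_∅) = 3^{t+a}·unit` from DICT3 at `∅` and
  `δ̃₁ = 3^a·unit`), the witness at a depth `k₂` with `t + a + k + 1 ≤ k₂ + 1` (for a class of FULL order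
  `3^{k+1}` in `H¹_{𝓕_can}(ℚ, E[3^{k+1}])`, file 1 §3), `#H¹_{𝓕_can} = 3^{k+1}·3^{n₀}` and
  `3^{k+1−n₀} g_∅ = 0` ([S24] Thm. 4.4 (2) at `∅` in ORDER form): `g_∅ ∈ 3^{n₀} H¹_{𝓕_can} + H¹_𝓚` —
  VERBATIM the binder `hStub` of w2-c3's `KimAtThreeDeepUpperOfPorts.deepUpper_conclusion_of_ports`
  (p431940) / `hstub` of `EndRow` (p425782): Mazur–Rubin's Thm. 4.4.1 at `∅` in the weakened form the
  upper ledger needs, WITHOUT Howard's section (App. B), WITHOUT the connectedness of `𝒳⁰` (Thm. 4.3.12)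
  and WITHOUT a Chebotarev choice.
The sequel `KimAtThreeShallowEqDeepStubOfPorts` plugs it into the END-OF-PORTS theorem.
[cite: MazurRubin2004, Thm. 4.4.1, Thm. 4.1.13 (i)] [cite: Sakamoto2024, Thm. 4.4 (2) (p. 926)]
[cite: Kim2022StructureSelmer, Thm. 3.13, Prop. 3.12 and §3.4.1] [cite: Kato2004Asterisque, Thm. 12.5 (1)]
-/

set_option autoImplicit false
-- the Theorems namespace of a single-conjunct summit repeats the summit name by design (D-0017)
set_option linter.dupNamespace false

noncomputable section

open scoped Classical NumberField ContRepresentation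
open Function Field NumberField IsDedekindDomain WeierstrassCurve
  Literature.NumberTheory.EllipticCurves
  Literature.NumberTheory.GaloisRepresentations
  Literature.NumberTheory.GaloisRepresentations.DiscreteGaloisModule Literature.NumberTheory.GaloisCohomology
  Summit.BirchSwinnertonDyer.Rank1Residual.GaloisImage

namespace Summit.BirchSwinnertonDyer.BirchSwinnertonDyer.Theorems.KimAtThreeShallowEqDeepStubOfWitnesses

open CongruenceSubgroup Literature.NumberTheory.EllipticCurves.ModularForms
  Literature.NumberTheory.EllipticCurves.Rank1Residual
  Summit.BirchSwinnertonDyer.BirchSwinnertonDyer.Theorems.KimAtThreeShallowEqDeepStubOfOrder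
  Summit.BirchSwinnertonDyer.BirchSwinnertonDyer.Theorems.KimAtThreeShallowEqDeepGoodCoreVertex

/-! ## §4. The weakened STUB at `∅` from the port's witnesses at two depths -/

section StubOfWitnesses

variable (W : WeierstrassCurve ℚ) [W.IsElliptic] [W.IsGloballyMinimal]

/-- **`#H¹_{𝓕_can} ≤ 3^{k+1} · #H¹_𝓚`, i.e. `n₀ ≤ s`**: `Λ ∘ loc₃` maps `H¹_{𝓕_can}(ℚ, E[3^{k+1}])` to
`ℤ/3^{k+1}` with kernel inside `H¹_𝓚` (the kernel clause of the dictionary functional, gen 3's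
`apply_localization_eq_zero_iff_mem_kummer_atLevel` at `∅`). [cite: Kim2022StructureSelmer, Prop. 3.12]
[cite: MazurRubin2004, Prop. 2.3.5] -/
theorem natCard_selmerGroup_le_of_ker {G : Type*} [AddCommGroup G] {K : ℕ} (p : ℕ) [Fact p.Prime]
    (F Kum : AddSubgroup G) [Finite Kum] (Φ : G →+ ZMod (p ^ K))
    (hkerΦ : ∀ y ∈ F, Φ y = 0 → y ∈ Kum) :
    Nat.card F ≤ p ^ K * Nat.card Kum := by
  haveI : NeZero (p ^ K) := ⟨pow_ne_zero _ (Fact.out : p.Prime).ne_zero⟩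
  set Φ' : F →+ ZMod (p ^ K) := Φ.comp F.subtype with hΦ'
  rw [AddSubgroup.card_eq_card_quotient_mul_card_addSubgroup Φ'.ker,
    Nat.card_congr (QuotientAddGroup.quotientKerEquivRange Φ').toEquiv]
  refine Nat.mul_le_mul ?_ ?_
  · calc Nat.card Φ'.range ≤ Nat.card (ZMod (p ^ K)) :=
          Nat.card_le_card_of_injective _ Subtype.val_injective
      _ = p ^ K := Nat.card_zmod _
  · refine Nat.card_le_card_of_injective
      (fun y : Φ'.ker => (⟨(y.1 : G), hkerΦ _ y.1.2 y.2⟩ : Kum)) fun y z h => ?_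
    have h' : ((⟨(y.1 : G), hkerΦ _ y.1.2 y.2⟩ : Kum) : G) =
        ((⟨(z.1 : G), hkerΦ _ z.1.2 z.2⟩ : Kum) : G) := congrArg Subtype.val h
    exact Subtype.ext (Subtype.ext h')

omit [W.IsGloballyMinimal] in
/-- **The kernel clause at the empty level**: for the dictionary functional `Λ` at `v₃` with
`ker Λ|_{𝓕_can(v₃)} = 𝓚(v₃)` (clause (Λ) of `KatoKuriharaWitnessAt`), a class of `H¹_{𝓕_can}(ℚ, E[3^{k+1}])`
killed by `Λ ∘ loc₃` lies in `H¹_𝓚(ℚ, E[3^{k+1}])` (gen 3's `apply_localization_eq_zero_iff_mem_kummer_atLevel`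
at the level `∅`, `𝓕(∅) = 𝓕`). [cite: Kim2022StructureSelmer, Prop. 3.12 and §3.4.1] [cite: MazurRubin2004, Prop. 2.3.5] -/
theorem mem_kummerSelmerGroup_of_apply_localization_eq_zero (k : ℕ)
    {v₃ : HeightOneSpectrum (𝓞 ℚ)} (hv₃ : ((3 : ℕ) : 𝓞 ℚ) ∈ v₃.asIdeal)
    (Λ : galoisCohomology ((W.torsionGaloisModule (((3 : ℕ) : ℤ) ^ k * ((3 : ℕ) : ℤ))).toLocal
      (Sum.inr v₃)) 1 →+ ZMod (3 ^ (k + 1)))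
    (hker : ∀ x ∈ propagatedSelmerStructure W 3 k (Sum.inr v₃),
      Λ x = 0 ↔ x ∈ W.kummerSelmerStructure (((3 : ℕ) : ℤ) ^ k * ((3 : ℕ) : ℤ)) (Sum.inr v₃))
    (D : KolyvaginDatum (W.torsionGaloisModule (((3 : ℕ) : ℤ) ^ k * ((3 : ℕ) : ℤ))))
    {y : galoisCohomology (W.torsionGaloisModule (((3 : ℕ) : ℤ) ^ k * ((3 : ℕ) : ℤ))) 1}
    (hy : y ∈ (propagatedSelmerStructure W 3 k).selmerGroup)
    (h0 : Λ (galoisCohomology.localization _ (Sum.inr v₃) 1 y) = 0) :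
    y ∈ (W.kummerSelmerStructure (((3 : ℕ) : ℤ) ^ k * ((3 : ℕ) : ℤ))).selmerGroup := by
  haveI : Fact (Nat.Prime 3) := ⟨Nat.prime_three⟩
  have hy' : y ∈ (D.atLevel (propagatedSelmerStructure W 3 k) ∅).selmerGroup := by
    rwa [atLevel_empty]
  have h := (apply_localization_eq_zero_iff_mem_kummer_atLevel W 3 k (by norm_num) hv₃ Λ hker D
    (d := ∅) (Finset.notMem_empty v₃) hy').1 h0
  rwa [atLevel_empty] at h

/-- **`#H¹_{𝓕_can}(ℚ, E[3^{k+1}]) ≤ 3^{k+1} · #H¹_𝓚(ℚ, E[3^{k+1}])` — i.e. `n₀ ≤ s` — from the witness's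
kernel clause** (clause (Λ) of `KatoKuriharaWitnessAt W k t D v₃ P κ Λ κ′`).
[cite: Kim2022StructureSelmer, Prop. 3.12] [cite: MazurRubin2004, Prop. 2.3.5] -/
theorem natCard_selmerGroup_le_of_witness {t : ℕ} (k : ℕ)
    (D : KolyvaginDatum (W.torsionGaloisModule (((3 : ℕ) : ℤ) ^ k * ((3 : ℕ) : ℤ))))
    (v₃ : HeightOneSpectrum (𝓞 ℚ)) (hv₃ : ((3 : ℕ) : 𝓞 ℚ) ∈ v₃.asIdeal)
    {N : ℕ} [NeZero N] (P : ModularParametrizationData W N)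
    {κ : Finset (HeightOneSpectrum (𝓞 ℚ)) →
      galoisCohomology (W.torsionGaloisModule (((3 : ℕ) : ℤ) ^ k * ((3 : ℕ) : ℤ))) 1}
    {Λ : galoisCohomology ((W.torsionGaloisModule (((3 : ℕ) : ℤ) ^ k * ((3 : ℕ) : ℤ))).toLocal
      (Sum.inr v₃)) 1 →+ ZMod (3 ^ (k + 1))}
    {κ' : Finset (HeightOneSpectrum (𝓞 ℚ)) →
      galoisCohomology (W.torsionGaloisModule (((3 : ℕ) : ℤ) ^ k * ((3 : ℕ) : ℤ))) 1}
    (hW : KatoKuriharaWitnessAt W k t D v₃ P κ Λ κ')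
    [Finite (W.kummerSelmerStructure (((3 : ℕ) : ℤ) ^ k * ((3 : ℕ) : ℤ))).selmerGroup] :
    Nat.card (propagatedSelmerStructure W 3 k).selmerGroup ≤
      3 ^ (k + 1) * Nat.card (W.kummerSelmerStructure (((3 : ℕ) : ℤ) ^ k * ((3 : ℕ) : ℤ))).selmerGroup := by
  haveI : Fact (Nat.Prime 3) := ⟨Nat.prime_three⟩
  obtain ⟨-, -, -, hker, -⟩ := hW
  exact natCard_selmerGroup_le_of_ker 3 _ _
    (Λ.comp (galoisCohomology.localization _ (Sum.inr v₃) 1)) fun y hy h0 =>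
      mem_kummerSelmerGroup_of_apply_localization_eq_zero W k hv₃ Λ hker D hy h0

/-- **The STUB at the empty level, WEAKENED form, at a DEEP level — from the port's witnesses at two
depths and [S24] Thm. 4.4 (2) at `∅` in order form; no Howard section, no `𝒳⁰`-connectedness, no
Chebotarev choice.**  Depth `k` (`K = k + 1`), a deeper depth `k₂ > k` with `t + a + K ≤ k₂ + 1`:
the witness `(κ, Λ, κ′)` at depth `k` supplies the functional `Φ = Λ ∘ loc₃` (kernel on `H¹_{𝓕_can}`
= `H¹_𝓚`) and `y₀ = κ_∅` with `Φ(κ_∅) = 3^{t+a}·unit` (DICT3 at `∅` + `δ̃₁ = 3^a·unit`); the witness at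
depth `k₂` supplies `κ₂_∅` of order `≥ 3^{k₂+1−t−a} ≥ 3^K`, hence (file 1, §3) a class
`x ∈ H¹_{𝓕_can}(ℚ, E[3^K])` of order `3^K`; with `#H¹_{𝓕_can} = 3^K·3^{n₀}`, `3^{K−n₀} g_∅ = 0` and
`2n₀ + t + a ≤ K`, file 1 §1 gives `g_∅ ∈ 3^{n₀} H¹_{𝓕_can} + H¹_𝓚` — VERBATIM the binder `hStub`/`hstub` of
`KimAtThreeDeepUpperOfPorts.deepUpper_conclusion_of_ports` (p431940) / `EndRow` (p425782).
[cite: MazurRubin2004, Thm. 4.4.1 and Thm. 4.1.13 (i)] [cite: Sakamoto2024, Thm. 4.4 (2) (p. 926)]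
[cite: Kim2022StructureSelmer, Thm. 3.13 and Prop. 3.12] -/
theorem exists_eq_nsmul_add_of_witnesses
    (hsurj : W.HasSurjectiveModNGaloisRep ((3 : ℕ) : ℤ))
    (t : ℕ) {k k₂ : ℕ} (hk : k < k₂)
    (D : KolyvaginDatum (W.torsionGaloisModule (((3 : ℕ) : ℤ) ^ k * ((3 : ℕ) : ℤ))))
    (D₂ : KolyvaginDatum (W.torsionGaloisModule (((3 : ℕ) : ℤ) ^ k₂ * ((3 : ℕ) : ℤ))))
    (v₃ : HeightOneSpectrum (𝓞 ℚ)) (hv₃ : ((3 : ℕ) : 𝓞 ℚ) ∈ v₃.asIdeal)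
    {N : ℕ} [NeZero N] (P : ModularParametrizationData W N)
    {κ : Finset (HeightOneSpectrum (𝓞 ℚ)) →
      galoisCohomology (W.torsionGaloisModule (((3 : ℕ) : ℤ) ^ k * ((3 : ℕ) : ℤ))) 1}
    {Λ : galoisCohomology ((W.torsionGaloisModule (((3 : ℕ) : ℤ) ^ k * ((3 : ℕ) : ℤ))).toLocal
      (Sum.inr v₃)) 1 →+ ZMod (3 ^ (k + 1))}
    {κ' : Finset (HeightOneSpectrum (𝓞 ℚ)) →
      galoisCohomology (W.torsionGaloisModule (((3 : ℕ) : ℤ) ^ k * ((3 : ℕ) : ℤ))) 1}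
    (hW : KatoKuriharaWitnessAt W k t D v₃ P κ Λ κ')
    {κ₂ : Finset (HeightOneSpectrum (𝓞 ℚ)) →
      galoisCohomology (W.torsionGaloisModule (((3 : ℕ) : ℤ) ^ k₂ * ((3 : ℕ) : ℤ))) 1}
    {Λ₂ : galoisCohomology ((W.torsionGaloisModule (((3 : ℕ) : ℤ) ^ k₂ * ((3 : ℕ) : ℤ))).toLocal
      (Sum.inr v₃)) 1 →+ ZMod (3 ^ (k₂ + 1))}
    {κ₂' : Finset (HeightOneSpectrum (𝓞 ℚ)) →
      galoisCohomology (W.torsionGaloisModule (((3 : ℕ) : ℤ) ^ k₂ * ((3 : ℕ) : ℤ))) 1}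
    (hW₂ : KatoKuriharaWitnessAt W k₂ t D₂ v₃ P κ₂ Λ₂ κ₂')
    (g : Finset (HeightOneSpectrum (𝓞 ℚ)) →
      galoisCohomology (W.torsionGaloisModule (((3 : ℕ) : ℤ) ^ k * ((3 : ℕ) : ℤ))) 1)
    (hg : g ∅ ∈ (propagatedSelmerStructure W 3 k).selmerGroup)
    {n₀ : ℕ} (hcount : Nat.card (propagatedSelmerStructure W 3 k).selmerGroup = 3 ^ (k + 1) * 3 ^ n₀)
    (hgK : 3 ^ (k + 1 - n₀) • g ∅ = 0)
    {a : ℕ} (w₀ : (ZMod (3 ^ (k + 1)))ˣ)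
    (hKur : ∀ ψ : (ℓ : ℕ) → (ZMod ℓ)ˣ →* Multiplicative (ZMod (3 ^ (k + 1))),
      kuriharaNumber P.f (3 ^ (k + 1)) 1 ψ = ((3 ^ a : ℕ) : ZMod (3 ^ (k + 1))) * (w₀ : ZMod _))
    (w₂ : (ZMod (3 ^ (k₂ + 1)))ˣ)
    (hKur₂ : ∀ ψ : (ℓ : ℕ) → (ZMod ℓ)ˣ →* Multiplicative (ZMod (3 ^ (k₂ + 1))),
      kuriharaNumber P.f (3 ^ (k₂ + 1)) 1 ψ = ((3 ^ a : ℕ) : ZMod (3 ^ (k₂ + 1))) * (w₂ : ZMod _))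
    (hdeep : t + a + (k + 1) ≤ k₂ + 1) (hK : 2 * n₀ + (t + a) ≤ k + 1) :
    ∃ e ∈ (propagatedSelmerStructure W 3 k).selmerGroup,
      ∃ m ∈ (W.kummerSelmerStructure (((3 : ℕ) : ℤ) ^ k * ((3 : ℕ) : ℤ))).selmerGroup,
        g ∅ = 3 ^ n₀ • e + m := by
  haveI : Fact (Nat.Prime 3) := ⟨Nat.prime_three⟩
  haveI : NeZero (3 ^ (k + 1)) := ⟨pow_ne_zero _ three_ne_zero⟩
  haveI : NeZero (3 ^ (k₂ + 1)) := ⟨pow_ne_zero _ three_ne_zero⟩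
  obtain ⟨hκmem, -, -, hker, hdict⟩ := hW
  obtain ⟨hκmem₂, -, -, -, hdict₂⟩ := hW₂
  -- `Φ = Λ ∘ loc₃` and its kernel clause on `H¹_{𝓕_can}` at `∅`
  set Φ : galoisCohomology (W.torsionGaloisModule (((3 : ℕ) : ℤ) ^ k * ((3 : ℕ) : ℤ))) 1 →+
      ZMod (3 ^ (k + 1)) := Λ.comp (galoisCohomology.localization _ (Sum.inr v₃) 1) with hΦ
  have hkerΦ : ∀ y ∈ (propagatedSelmerStructure W 3 k).selmerGroup, Φ y = 0 →
      y ∈ (W.kummerSelmerStructure (((3 : ℕ) : ℤ) ^ k * ((3 : ℕ) : ℤ))).selmerGroup :=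
    fun y hy h0 => mem_kummerSelmerGroup_of_apply_localization_eq_zero W k hv₃ Λ hker D hy h0
  -- `y₀ = κ_∅`, `Φ(κ_∅) = 3^{t+a} · unit`
  have hκ0 : κ ∅ ∈ (propagatedSelmerStructure W 3 k).selmerGroup := by
    have h := hκmem ∅ D.isLevel_empty
    rwa [atLevel_empty] at h
  obtain ⟨u, ψ₀, -, hval₀⟩ := hdict ∅ D.isLevel_empty
  have hδ₁ : Λ (galoisCohomology.localization _ (Sum.inr v₃) 1 (κ ∅)) =
      (u : ZMod (3 ^ (k + 1))) * (3 : ZMod (3 ^ (k + 1))) ^ t *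
        (((3 ^ a : ℕ) : ZMod (3 ^ (k + 1))) * (w₀ : ZMod _)) := by
    rw [hval₀]
    congr 1
    have h1 := hKur ψ₀
    simpa using h1
  have hΦy₀ : Φ (κ ∅) = ((3 ^ (t + a) : ℕ) : ZMod (3 ^ (k + 1))) *
      ((u * w₀ : (ZMod (3 ^ (k + 1)))ˣ) : ZMod (3 ^ (k + 1))) := by
    rw [hΦ, AddMonoidHom.comp_apply, hδ₁, Units.val_mul]
    push_cast
    ring
  -- the deeper class `κ₂_∅`: `3^{k+1} ∣ ord(κ₂_∅)`
  have hκ₂0 : κ₂ ∅ ∈ (propagatedSelmerStructure W 3 k₂).selmerGroup := by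
    have h := hκmem₂ ∅ D₂.isLevel_empty
    rwa [atLevel_empty] at h
  obtain ⟨u₂, ψ₂, -, hval₂⟩ := hdict₂ ∅ D₂.isLevel_empty
  have hδ₂ : Λ₂ (galoisCohomology.localization _ (Sum.inr v₃) 1 (κ₂ ∅)) =
      (u₂ : ZMod (3 ^ (k₂ + 1))) * (3 : ZMod (3 ^ (k₂ + 1))) ^ t *
        (((3 ^ a : ℕ) : ZMod (3 ^ (k₂ + 1))) * (w₂ : ZMod _)) := by
    rw [hval₂]
    congr 1
    have h1 := hKur₂ ψ₂
    simpa using h1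
  obtain ⟨j, -, hj⟩ := (Nat.dvd_prime_pow Nat.prime_three).1
    (addOrderOf_dvd_of_nsmul_eq_zero (Transport.pow_succ_nsmul_galoisCohomology W k₂ (κ₂ ∅)))
  have hjge : k + 1 ≤ j := by
    by_contra hle
    have hlt : j < k + 1 := Nat.lt_of_not_le hle
    have h0 : 3 ^ j • κ₂ ∅ = 0 := by rw [← hj]; exact addOrderOf_nsmul_eq_zero (κ₂ ∅)
    have h1 : ((3 ^ (j + (t + a)) : ℕ) : ZMod (3 ^ (k₂ + 1))) *
        ((u₂ * w₂ : (ZMod (3 ^ (k₂ + 1)))ˣ) : ZMod (3 ^ (k₂ + 1))) = 0 := by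
      have h2 : Λ₂ (galoisCohomology.localization _ (Sum.inr v₃) 1 (3 ^ j • κ₂ ∅)) = 0 := by
        rw [h0, map_zero, map_zero]
      rw [map_nsmul, map_nsmul, hδ₂, nsmul_eq_mul] at h2
      rw [Units.val_mul, ← h2]
      push_cast
      ring
    exact DeepLedger.pow_mul_unit_ne_zero 3 (by omega : j + (t + a) < k₂ + 1) (u₂ * w₂) h1
  have hdvd : 3 ^ (k + 1) ∣ addOrderOf (κ₂ ∅) := by rw [hj]; exact pow_dvd_pow 3 hjge
  obtain ⟨x, hx, hxord⟩ := exists_mem_selmerGroup_addOrderOf_eq_of_deep W hk hsurj hκ₂0 hdvd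
  -- the algebra of file 1, §1 (`p = 3`, `K = k + 1`, `c = t + a`)
  exact Stub.exists_eq_nsmul_add_of_addOrderOf 3 _ _ Φ hkerΦ hcount hx hxord hg hgK hκ0 (u * w₀)
    hΦy₀ hK

end StubOfWitnesses

end Summit.BirchSwinnertonDyer.BirchSwinnertonDyer.Theorems.KimAtThreeShallowEqDeepStubOfWitnesses

end
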